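import Literature.NumberTheory.Transcendental.QuadraticRelationsLogarithmsSec5Box
import Mathlib.LinearAlgebra.Dual.Lemmas
import HarnessLib

/-!
# Roy–Waldschmidt 1997, §4: the torus part of the obstruction subgroup (towards Théorème 4.1)

D. Roy, M. Waldschmidt, *Approximation diophantienne et indépendance algébrique de logarithmes*,
Ann. Sci. ÉNS (4) 30 (1997) 753–796, §4, Lemme 4.8 (p. 776) and step 2 of the proof of
Théorème 4.1 (p. 777).

Lemme 4.8 of the paper bounds, via Mahler's theorem on successive minima, a basis of the lattice
`Φ₁` of characters trivial on a subtorus `H₁ ⊆ 𝔾ₘ^{d₁}` that is "incompletely defined by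
polynomials of degree `≤ Tᵢ` in `Yᵢ`".  For the proof of Théorème 4.1 only the following
consequence is needed, which we prove directly (`exists_zsmul_mem_boxDiffLattice`): **every
`φ ∈ Φ₁` has a nonzero multiple in the lattice `Φ` generated by the differences `α - β ∈ Φ₁` of
exponents in the box `[0, T₁]^{d₁}`**.  The argument is the one of the paper's proof of Lemme 4.8
(Artin's theorem on the independence of characters, `sum_eq_zero_of_vanish`), combined with the
maximality of `H` (the meaning of "incompletely defined", as in the hypothesis `h41` of
`…Sec5Local.lean`) applied to the connected subgroup `E × T_{Φ^{sat}} ⊇ H`, and with the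
duality between saturated character lattices and subtori (`monChar_eq_iff`,
`exists_mem_toSubgroup_zpow_ne_one`).

No named facts.

## References

* [RoyWaldschmidt1997ENS] D. Roy, M. Waldschmidt, Ann. Sci. ÉNS (4) 30 (1997) 753–796, §4,
  Lemme 4.8 p. 776, proof of Théorème 4.1 step 2, p. 777.
-/

noncomputable section

open Complex

namespace Literature.NumberTheory.Transcendental

namespace LinGroup

namespace ConnAlgSubgroup

variable {d₀ d₁ : ℕ}

/-- Elements of the `ℚ`-span of integer vectors have an integer multiple in their `ℤ`-span.
[folklore] -/
theorem exists_nsmul_mem_of_mem_span_rat (S : AddSubgroup (Fin d₁ → ℤ)) {x : Fin d₁ → ℚ}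
    (hx : x ∈ Submodule.span ℚ ((fun χ : Fin d₁ → ℤ => fun j => (χ j : ℚ)) '' (S : Set (Fin d₁ → ℤ)))) :
    ∃ n : ℕ, 0 < n ∧ ∃ μ ∈ S, (fun j => (μ j : ℚ)) = n • x := by
  induction hx using Submodule.span_induction with
  | mem y hy =>
    obtain ⟨χ, hχ, rfl⟩ := hy
    exact ⟨1, one_pos, χ, hχ, by simp⟩
  | zero => exact ⟨1, one_pos, 0, S.zero_mem, by funext j; simp⟩
  | add y z _ _ hy hz =>
    obtain ⟨n₁, hn₁, μ₁, hμ₁, h₁⟩ := hy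
    obtain ⟨n₂, hn₂, μ₂, hμ₂, h₂⟩ := hz
    refine ⟨n₁ * n₂, Nat.mul_pos hn₁ hn₂, n₂ • μ₁ + n₁ • μ₂, S.add_mem (S.nsmul_mem hμ₁ _) (S.nsmul_mem hμ₂ _), ?_⟩
    funext j
    have e1 := congrFun h₁ j
    have e2 := congrFun h₂ j
    simp only [Pi.smul_apply, nsmul_eq_mul] at e1 e2
    simp only [Pi.smul_apply, nsmul_eq_mul, Pi.add_apply, Pi.mul_apply, Pi.natCast_apply]
    push_cast
    rw [e1, e2]; ring
  | smul c y _ hy =>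
    obtain ⟨n, hn, μ, hμ, h⟩ := hy
    refine ⟨n * c.den, Nat.mul_pos hn c.den_pos, c.num • μ, S.zsmul_mem hμ _, ?_⟩
    funext j
    have e := congrFun h j
    simp only [Pi.smul_apply, nsmul_eq_mul] at e
    simp only [Pi.smul_apply, smul_eq_mul, nsmul_eq_mul, Int.cast_mul]
    push_cast
    rw [e]
    have hc : (c.num : ℚ) = c * c.den := by rw [Rat.mul_den_eq_num]
    rw [hc]; ring

/-- **Duality for a subtorus**: if `φ ∉ M` (`M` the saturated character lattice of `L`), some
point `g` of `L` has `∏ⱼ gⱼ^{φⱼ} ≠ 1` (take `g = exp_G(0, v)` with `v ∈ ℚ^{d₁}`, `⟨χ, v⟩ = 0`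
for `χ ∈ M`, `⟨φ, v⟩ = 1`). [folklore] -/
theorem exists_mem_toSubgroup_zpow_ne_one (L : ConnAlgSubgroup d₀ d₁) {φ : Fin d₁ → ℤ} (hφ : φ ∉ L.chars) :
    ∃ g ∈ L.toSubgroup, ∏ j, (g.2 j) ^ (φ j) ≠ 1 := by
  classical
  set ι : (Fin d₁ → ℤ) → (Fin d₁ → ℚ) := fun χ j => (χ j : ℚ) with hι
  set Mℚ : Submodule ℚ (Fin d₁ → ℚ) := Submodule.span ℚ (ι '' (L.chars : Set (Fin d₁ → ℤ))) with hMℚ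
  have hφℚ : ι φ ∉ Mℚ := by
    intro hmem
    obtain ⟨n, hn, μ, hμ, h⟩ := exists_nsmul_mem_of_mem_span_rat L.chars hmem
    have hμ' : μ = (n : ℤ) • φ := by
      funext j
      have e := congrFun h j
      simp only [hι, Pi.smul_apply, nsmul_eq_mul] at e
      have : (μ j : ℚ) = ((n : ℤ) * φ j : ℤ) := by push_cast; exact e
      simpa using (Int.cast_injective (α := ℚ) this : μ j = (n : ℤ) * φ j)
    rw [hμ'] at hμ
    exact hφ (L.saturated n φ (by exact_mod_cast hn.ne') hμ)
  -- a `ℚ`-linear functional vanishing on `Mℚ` with value `1` at `φ`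
  haveI : Module.Projective ℚ ((Fin d₁ → ℚ) ⧸ Mℚ) := Module.Projective.of_free
  obtain ⟨f, hfφ, hfM⟩ := Mℚ.exists_dual_map_eq_bot_of_notMem hφℚ inferInstance
  -- the vector `v = (f eⱼ)/f(φ)` and the point `g = exp_G(0, v)`
  set v : Fin d₁ → ℂ := fun j => ((f (Pi.single j 1) / f (ι φ) : ℚ) : ℂ) with hv
  have hfx : ∀ x : Fin d₁ → ℚ, f x = ∑ j, x j * f (Pi.single j 1) := by
    intro x
    conv_lhs => rw [show x = ∑ j, x j • (Pi.single j (1 : ℚ) : Fin d₁ → ℚ) from by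
      funext i; simp [Finset.sum_apply, Pi.single_apply]]
    rw [map_sum]
    simp [smul_eq_mul]
  have hsumχ : ∀ χ : Fin d₁ → ℤ, ∑ j, (χ j : ℂ) * v j = ((f (ι χ) / f (ι φ) : ℚ) : ℂ) := by
    intro χ
    rw [hfx (ι χ)]
    simp only [hv, hι]
    push_cast
    rw [Finset.sum_div, ]
    refine Finset.sum_congr rfl fun j _ => by ring
  refine ⟨LinGroup.exp ((0 : Fin d₀ → ℂ), v), ?_, ?_⟩
  · rw [mem_toSubgroup_iff]
    refine ⟨by simp [LinGroup.exp], fun χ hχ => ?_⟩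
    have hfχ : f (ι χ) = 0 := by
      have h1 : f (ι χ) ∈ Mℚ.map f := Submodule.mem_map_of_mem (Submodule.subset_span ⟨χ, hχ, rfl⟩)
      rw [hfM, Submodule.mem_bot] at h1
      exact h1
    have hprod : ((∏ j, ((LinGroup.exp ((0 : Fin d₀ → ℂ), v)).2 j) ^ (χ j) : ℂˣ) : ℂ) =
        cexp (∑ j, (χ j : ℂ) * v j) := by
      push_cast
      rw [Complex.exp_sum]
      refine Finset.prod_congr rfl fun j _ => ?_
      rw [LinGroup.coe_exp_snd, ← Complex.exp_int_mul]
    apply Units.ext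
    rw [hprod, Units.val_one, hsumχ, hfχ, zero_div]; simp
  · have hprod : ((∏ j, ((LinGroup.exp ((0 : Fin d₀ → ℂ), v)).2 j) ^ (φ j) : ℂˣ) : ℂ) =
        cexp (∑ j, (φ j : ℂ) * v j) := by
      push_cast
      rw [Complex.exp_sum]
      refine Finset.prod_congr rfl fun j _ => ?_
      rw [LinGroup.coe_exp_snd, ← Complex.exp_int_mul]
    rw [Ne, Units.ext_iff, hprod, Units.val_one, hsumχ, div_self hfφ]
    push_cast
    -- `e ≠ 1`
    intro h
    have h2 : Real.exp 1 = 1 := by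
      have h3 : cexp 1 = 1 := h
      have h4 : (Real.exp 1 : ℂ) = 1 := by rw [Complex.ofReal_exp, Complex.ofReal_one]; exact h3
      exact_mod_cast h4
    have := Real.exp_one_gt_d9
    linarith


/-- On `L`, monomials with exponents congruent modulo the character lattice agree. [folklore] -/
theorem prod_zpow_eq_of_sub_mem (L : ConnAlgSubgroup d₀ d₁) {g : LinGroup d₀ d₁} (hg : g ∈ L.toSubgroup)
    {α β : Fin d₁ → ℤ} (h : α - β ∈ L.chars) :
    ∏ j, (g.2 j) ^ (α j) = ∏ j, (g.2 j) ^ (β j) := by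
  have h1 := ((mem_toSubgroup_iff L g).mp hg).2 _ h
  simp only [Pi.sub_apply, zpow_sub, Finset.prod_mul_distrib, Finset.prod_inv_distrib,
    mul_inv_eq_one] at h1
  exact h1

/-- The torus points `T_M(ℂ) = {y ; y^χ = 1 (χ ∈ M)}` of `L`, as a subgroup of `(ℂˣ)^{d₁}`.
[folklore] -/
def torusPoints (L : ConnAlgSubgroup d₀ d₁) : Subgroup (Fin d₁ → ℂˣ) where
  carrier := {y | ∀ χ ∈ L.chars, ∏ j, (y j) ^ (χ j) = 1}
  one_mem' := fun χ _ => by simp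
  mul_mem' := fun {a b} ha hb χ hχ => by
    simp only [Pi.mul_apply, mul_zpow, Finset.prod_mul_distrib, ha χ hχ, hb χ hχ, mul_one]
  inv_mem' := fun {a} ha χ hχ => by
    simp only [Pi.inv_apply, inv_zpow, Finset.prod_inv_distrib, ha χ hχ, inv_one]

/-- Membership in the torus points. [folklore] -/
theorem mem_torusPoints (L : ConnAlgSubgroup d₀ d₁) (y : Fin d₁ → ℂˣ) :
    y ∈ L.torusPoints ↔ ∀ χ ∈ L.chars, ∏ j, (y j) ^ (χ j) = 1 := Iff.rfl

/-- `(x, y) ∈ L` for `x ∈ E` and `y ∈ T_M(ℂ)`. [folklore] -/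
theorem mk_mem_toSubgroup (L : ConnAlgSubgroup d₀ d₁) {x : Fin d₀ → ℂ} (hx : x ∈ L.addPart)
    {y : Fin d₁ → ℂˣ} (hy : y ∈ L.torusPoints) :
    ((Multiplicative.ofAdd x, y) : LinGroup d₀ d₁) ∈ L.toSubgroup :=
  (mem_toSubgroup_iff L _).mpr ⟨hx, hy⟩

/-- The monomial character `y ↦ ∏ⱼ yⱼ^{αⱼ}` on the torus points. [folklore] -/
def monChar (L : ConnAlgSubgroup d₀ d₁) (α : Fin d₁ → ℕ) : L.torusPoints →* ℂ where
  toFun y := ∏ j, ((y : Fin d₁ → ℂˣ) j : ℂ) ^ (α j)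
  map_one' := by simp
  map_mul' a b := by
    simp only [Subgroup.coe_mul, Pi.mul_apply, Units.val_mul, mul_pow, Finset.prod_mul_distrib]

/-- Value of a monomial character. [folklore] -/
theorem monChar_apply (L : ConnAlgSubgroup d₀ d₁) (α : Fin d₁ → ℕ) (y : L.torusPoints) :
    L.monChar α y = ∏ j, ((y : Fin d₁ → ℂˣ) j : ℂ) ^ (α j) := rfl

/-- Two monomial characters agree on `T_M(ℂ)` iff their exponents are congruent modulo `M`
(duality). [folklore] -/
theorem monChar_eq_iff (L : ConnAlgSubgroup d₀ d₁) (α β : Fin d₁ → ℕ) :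
    L.monChar α = L.monChar β ↔ (fun j => (α j : ℤ) - β j) ∈ L.chars := by
  constructor
  · intro h
    by_contra hn
    obtain ⟨g, hg, hne⟩ := L.exists_mem_toSubgroup_zpow_ne_one hn
    apply hne
    have hy : g.2 ∈ L.torusPoints := ((mem_toSubgroup_iff L g).mp hg).2
    have h1 := DFunLike.congr_fun h ⟨g.2, hy⟩
    rw [monChar_apply, monChar_apply] at h1
    simp only [zpow_sub, Finset.prod_mul_distrib, Finset.prod_inv_distrib, mul_inv_eq_one, zpow_natCast]
    apply Units.ext
    push_cast
    exact h1
  · intro h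
    ext y
    rw [monChar_apply, monChar_apply]
    have h1 := y.2 _ h
    simp only [zpow_sub, Finset.prod_mul_distrib, Finset.prod_inv_distrib, mul_inv_eq_one, zpow_natCast] at h1
    have h2 := congrArg (fun u : ℂˣ => (u : ℂ)) h1
    push_cast at h2
    exact h2

/-- **Evaluation of `P` at `g = (x, y)`, monomial by monomial.** [folklore] -/
theorem evalAt_eq_sum (P : MvPolynomial (Fin d₀ ⊕ Fin d₁) ℂ) (g : LinGroup d₀ d₁) :
    evalAt P g = ∑ m ∈ P.support, P.coeff m * (∏ i, (Multiplicative.toAdd g.1 i) ^ (m (Sum.inl i))) *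
      ∏ j, ((g.2 j : ℂ)) ^ (m (Sum.inr j)) := by
  rw [evalAt_eq_eval, MvPolynomial.eval_eq']
  refine Finset.sum_congr rfl fun m _ => ?_
  rw [Fintype.prod_sum_type, mul_assoc]
  rfl

/-- **Artin's independence of characters, applied**: if `P` vanishes on `H`, then for
`x ∈ E` the sums of the coefficients `c_α(x) = ∑_{m : m_Y = α} P_m x^{m_X}` over each class of
`Y`-exponents modulo `M` vanish; consequently `∑_α c_α(x) y'^α = 0` for every `y'` on which
congruent exponents occurring in `P` give equal monomials.
[cite: RoyWaldschmidt1997ENS, proof of Lemme 4.8, p. 776] -/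
theorem sum_eq_zero_of_vanish (H : ConnAlgSubgroup d₀ d₁) (P : MvPolynomial (Fin d₀ ⊕ Fin d₁) ℂ)
    (hvan : ∀ g ∈ H.toSubgroup, evalAt P g = 0) {x : Fin d₀ → ℂ} (hx : x ∈ H.addPart)
    (y' : Fin d₁ → ℂˣ)
    (hy' : ∀ m ∈ P.support, ∀ m' ∈ P.support,
      (fun j => ((m (Sum.inr j) : ℕ) : ℤ) - (m' (Sum.inr j) : ℕ)) ∈ H.chars →
      ∏ j, ((y' j : ℂ)) ^ (m (Sum.inr j)) = ∏ j, ((y' j : ℂ)) ^ (m' (Sum.inr j))) :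
    evalAt P ((Multiplicative.ofAdd x, y') : LinGroup d₀ d₁) = 0 := by
  classical
  -- coefficients `c m = P_m x^{m_X}` and characters `f m = monChar (m_Y)`
  set c : ((Fin d₀ ⊕ Fin d₁) →₀ ℕ) → ℂ := fun m => P.coeff m * ∏ i, x i ^ (m (Sum.inl i)) with hc
  set f : ((Fin d₀ ⊕ Fin d₁) →₀ ℕ) → (H.torusPoints →* ℂ) := fun m => H.monChar (fun j => m (Sum.inr j)) with hf
  -- the finitely supported family of coefficients on `Hom(T, ℂ)`
  set l : (H.torusPoints →* ℂ) →₀ ℂ := ∑ m ∈ P.support, Finsupp.single (f m) (c m) with hl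
  have hcomb : (Finsupp.linearCombination ℂ (fun φ : H.torusPoints →* ℂ => (φ : H.torusPoints → ℂ))) l = 0 := by
    rw [hl, map_sum]
    funext y
    simp only [Finsupp.linearCombination_single, Finset.sum_apply, Pi.smul_apply, smul_eq_mul]
    have h := hvan _ (H.mk_mem_toSubgroup hx y.2)
    rw [evalAt_eq_sum] at h
    rw [Pi.zero_apply, ← h]
    refine Finset.sum_congr rfl fun m _ => ?_
    simp only [hc, hf, monChar_apply]
    rfl
  have hl0 : l = 0 := (linearIndependent_iff.mp (linearIndependent_monoidHom H.torusPoints ℂ)) l hcomb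
  -- fibre sums vanish
  have hfib : ∀ φ : H.torusPoints →* ℂ, ∑ m ∈ P.support with f m = φ, c m = 0 := by
    intro φ
    have h1 : ∑ m ∈ P.support with f m = φ, c m = l φ := by
      rw [hl, Finsupp.finsetSum_apply, Finset.sum_filter]
      simp only [Finsupp.single_apply]
    rw [h1, hl0]; rfl
  -- regroup the evaluation at `(x, y')` by fibres
  rw [evalAt_eq_sum]
  have hval : ∀ m ∈ P.support, ∀ m' ∈ P.support, f m = f m' →
      ∏ j, ((y' j : ℂ)) ^ (m (Sum.inr j)) = ∏ j, ((y' j : ℂ)) ^ (m' (Sum.inr j)) := by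
    intro m hm m' hm' hff
    exact hy' m hm m' hm' ((H.monChar_eq_iff _ _).mp hff)
  -- the common value on a fibre
  set V : (H.torusPoints →* ℂ) → ℂ := fun φ =>
    if h : ∃ m ∈ P.support, f m = φ then ∏ j, ((y' j : ℂ)) ^ (h.choose (Sum.inr j)) else 0 with hV
  have hVm : ∀ m ∈ P.support, ∏ j, ((y' j : ℂ)) ^ (m (Sum.inr j)) = V (f m) := by
    intro m hm
    have hex : ∃ m' ∈ P.support, f m' = f m := ⟨m, hm, rfl⟩
    rw [hV]; simp only [dif_pos hex]
    exact hval m hm _ hex.choose_spec.1 hex.choose_spec.2.symm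
  calc ∑ m ∈ P.support, P.coeff m * (∏ i, (Multiplicative.toAdd ((Multiplicative.ofAdd x, y') : LinGroup d₀ d₁).1 i) ^ (m (Sum.inl i))) *
        ∏ j, ((((Multiplicative.ofAdd x, y') : LinGroup d₀ d₁).2 j : ℂ)) ^ (m (Sum.inr j))
      = ∑ m ∈ P.support, c m * V (f m) := by
        refine Finset.sum_congr rfl fun m hm => ?_
        rw [← hVm m hm]
        rfl
    _ = ∑ φ ∈ P.support.image f, ∑ m ∈ P.support with f m = φ, c m * V (f m) := by
        rw [Finset.sum_fiberwise_of_maps_to (fun m hm => Finset.mem_image_of_mem f hm)]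
    _ = ∑ φ ∈ P.support.image f, (∑ m ∈ P.support with f m = φ, c m) * V φ := by
        refine Finset.sum_congr rfl fun φ _ => ?_
        rw [Finset.sum_mul]
        refine Finset.sum_congr rfl fun m hm => ?_
        rw [(Finset.mem_filter.mp hm).2]
    _ = 0 := Finset.sum_eq_zero fun φ _ => by rw [hfib φ, zero_mul]

/-- The saturation `{χ ; kχ ∈ Φ for some k ≠ 0}` of a lattice of characters. [folklore] -/
def satClosure (Φ : AddSubgroup (Fin d₁ → ℤ)) : AddSubgroup (Fin d₁ → ℤ) where
  carrier := {χ | ∃ k : ℤ, k ≠ 0 ∧ k • χ ∈ Φ}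
  zero_mem' := ⟨1, one_ne_zero, by rw [smul_zero]; exact Φ.zero_mem⟩
  add_mem' := by
    rintro a b ⟨k₁, hk₁, h₁⟩ ⟨k₂, hk₂, h₂⟩
    refine ⟨k₁ * k₂, mul_ne_zero hk₁ hk₂, ?_⟩
    rw [smul_add, mul_comm k₁ k₂, mul_smul, mul_comm k₂ k₁, mul_smul]
    exact Φ.add_mem (Φ.zsmul_mem h₁ _) (Φ.zsmul_mem h₂ _)
  neg_mem' := by
    rintro a ⟨k, hk, h⟩
    exact ⟨k, hk, by rw [smul_neg]; exact Φ.neg_mem h⟩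

/-- Membership in the saturation. [folklore] -/
theorem mem_satClosure (Φ : AddSubgroup (Fin d₁ → ℤ)) (χ : Fin d₁ → ℤ) :
    χ ∈ satClosure Φ ↔ ∃ k : ℤ, k ≠ 0 ∧ k • χ ∈ Φ := Iff.rfl

/-- `Φ ⊆ Φ^{sat}`. [folklore] -/
theorem le_satClosure (Φ : AddSubgroup (Fin d₁ → ℤ)) : Φ ≤ satClosure Φ :=
  fun χ h => ⟨1, one_ne_zero, by rw [one_smul]; exact h⟩

/-- `Φ^{sat}` is saturated. [folklore] -/
theorem satClosure_saturated (Φ : AddSubgroup (Fin d₁ → ℤ)) :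
    ∀ (k : ℤ) (χ : Fin d₁ → ℤ), k ≠ 0 → k • χ ∈ satClosure Φ → χ ∈ satClosure Φ := by
  rintro k χ hk ⟨k', hk', h⟩
  exact ⟨k' * k, mul_ne_zero hk' hk, by rw [mul_smul]; exact h⟩

/-- The lattice `Φ` generated by the differences `α - β ∈ M` of exponents in the box
`[0, T₁]^{d₁}` ("Φ engendré par les points α - β avec α, β ∈ E et α - β ∈ Φ₁").
[cite: RoyWaldschmidt1997ENS, proof of Lemme 4.8, p. 776] -/
def boxDiffLattice (H : ConnAlgSubgroup d₀ d₁) (T₁ : ℕ) : AddSubgroup (Fin d₁ → ℤ) :=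
  AddSubgroup.closure {ψ | ∃ α β : Fin d₁ → ℕ, (∀ j, α j ≤ T₁) ∧ (∀ j, β j ≤ T₁) ∧
    ψ = (fun j => (α j : ℤ) - β j) ∧ ψ ∈ H.chars}

/-- `Φ ⊆ Φ₁ = M`. [cite: RoyWaldschmidt1997ENS, proof of Lemme 4.8, p. 776] -/
theorem boxDiffLattice_le (H : ConnAlgSubgroup d₀ d₁) (T₁ : ℕ) : H.boxDiffLattice T₁ ≤ H.chars := by
  rw [boxDiffLattice, AddSubgroup.closure_le]
  rintro ψ ⟨α, β, -, -, -, h⟩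
  exact h

/-- **Finite index of `Φ` in `Φ₁` from maximality** (replacing Lemme 4.8 / Mahler): if `H` is
the largest connected algebraic subgroup containing `H` on which the polynomials of `F` (of
degree `≤ T₁` in each `Yᵢ`) vanish, then every character `φ ∈ M` trivial on the torus part of `H`
has a nonzero multiple in the lattice generated by the box differences `α - β ∈ M`,
`α, β ∈ [0, T₁]^{d₁}`.  (Artin's independence of characters shows that `F` vanishes on the
connected subgroup `H' = E × T_{Φ^{sat}} ⊇ H`, so `H' = H` and `Φ^{sat} = M`.)
[cite: RoyWaldschmidt1997ENS, Lemme 4.8 and its proof, p. 776] -/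
theorem exists_zsmul_mem_boxDiffLattice (H : ConnAlgSubgroup d₀ d₁) (T₁ : ℕ)
    (F : Set (MvPolynomial (Fin d₀ ⊕ Fin d₁) ℂ)) (hF : ∀ P ∈ F, ∀ i, P.degreeOf (Sum.inr i) ≤ T₁)
    (hvan : ∀ g ∈ H.toSubgroup, ∀ P ∈ F, evalAt P g = 0)
    (hmax : ∀ H' : ConnAlgSubgroup d₀ d₁, H.toSubgroup ≤ H'.toSubgroup →
      (∀ g ∈ H'.toSubgroup, ∀ P ∈ F, evalAt P g = 0) → H'.toSubgroup = H.toSubgroup)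
    {φ : Fin d₁ → ℤ} (hφ : φ ∈ H.chars) :
    ∃ k : ℤ, k ≠ 0 ∧ k • φ ∈ H.boxDiffLattice T₁ := by
  classical
  set Φ := H.boxDiffLattice T₁ with hΦ
  have hΦle : Φ ≤ H.chars := H.boxDiffLattice_le T₁
  have hsatle : satClosure Φ ≤ H.chars := by
    rintro χ ⟨k, hk, h⟩
    exact H.saturated k χ hk (hΦle h)
  set H' : ConnAlgSubgroup d₀ d₁ := ⟨H.addPart, satClosure Φ, satClosure_saturated Φ⟩ with hH'
  have hle : H.toSubgroup ≤ H'.toSubgroup := by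
    intro g hg
    rw [mem_toSubgroup_iff] at hg ⊢
    exact ⟨hg.1, fun χ hχ => hg.2 χ (hsatle hχ)⟩
  have hvan' : ∀ g ∈ H'.toSubgroup, ∀ P ∈ F, evalAt P g = 0 := by
    intro g' hg' P hP
    have hx : Multiplicative.toAdd g'.1 ∈ H.addPart := ((mem_toSubgroup_iff H' g').mp hg').1
    have h := sum_eq_zero_of_vanish H P (fun g hg => hvan g hg P hP) hx g'.2 ?_
    · exact h
    intro m hm m' hm' hψ
    -- `m_Y - m'_Y` is a box difference in `M`, hence in `Φ ⊆ Φ^{sat} = M(H')`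
    have hψΦ : (fun j => ((m (Sum.inr j) : ℕ) : ℤ) - (m' (Sum.inr j) : ℕ)) ∈ satClosure Φ := by
      apply le_satClosure
      apply AddSubgroup.subset_closure
      refine ⟨fun j => m (Sum.inr j), fun j => m' (Sum.inr j), fun j => ?_, fun j => ?_, rfl, hψ⟩
      · exact (MvPolynomial.monomial_le_degreeOf (Sum.inr j) hm).trans (hF P hP j)
      · exact (MvPolynomial.monomial_le_degreeOf (Sum.inr j) hm').trans (hF P hP j)
    have h1 := prod_zpow_eq_of_sub_mem H' hg' (α := fun j => ((m (Sum.inr j) : ℕ) : ℤ))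
      (β := fun j => ((m' (Sum.inr j) : ℕ) : ℤ)) hψΦ
    simp only [zpow_natCast] at h1
    have h2 := congrArg (fun u : ℂˣ => (u : ℂ)) h1
    push_cast at h2
    exact h2
  have heq := hmax H' hle hvan'
  -- `φ ∈ Φ^{sat}` by duality for `H'`
  by_contra hn
  have hn' : φ ∉ H'.chars := fun h => hn h
  obtain ⟨g, hg, hne⟩ := H'.exists_mem_toSubgroup_zpow_ne_one hn'
  rw [heq] at hg
  exact hne (((mem_toSubgroup_iff H g).mp hg).2 φ hφ)
end ConnAlgSubgroup
end LinGroup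
end Literature.NumberTheory.Transcendental
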